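import Literature.NumberTheory.Rogawski1990.ArchTransfFamilyWeyl                 -- ★ p849820∕ED. 2 p849904 (LH7-p02 (g2)): (W) and its PER-LABEL forms `transfFam_flipAt_mul_archRH_at`, `transfFam_negXAt_at`
import Literature.NumberTheory.Rogawski1990.ArchExplicitTransferFactorStable      -- ★ p849871 (LH10-p02 (g3)): `archExplicitDelta_endoTorus_flipAt` ∕ `_negXAt` (`hΔflip`, `hΔnegH`)
import Literature.NumberTheory.Rogawski1990.ArchExplicitTransferFactorNegX        -- ★ p849882 (this seat): `archExplicitDelta_gprimeTorus_negXAt_of_forall` (`hΔnegG` under the split-chart guard)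
import Literature.NumberTheory.Rogawski1990.ArchDefinitePlaceNoSplitPartner       -- ★ `charpoly_archPiEquivCM_of_isArchNormPair` (norm pairs match characteristic polynomials place by place)
import HarnessLib

/-!
# (W) DISCHARGED: `ArchBzWeyl (transfFam L α μ F)` from `ArchHcWeyl` of `F` and continuity on the admissible labels alone — the inadmissible labels carry the ZERO family
# ((W-DISCHARGE) — LH3-plan (g2) deal 2026-09-02T06:34:00Z; Rogawski 1990 §4.3, §14.2; Shelstad 1979 §4; Bouaziz 1994 §3.1, §6.2)

Topic `NumberTheory/Rogawski1990`; namespace `Literature.NumberTheory.Rogawski1990`.  THEOREMS ONLY (no definition, no instance, no notation, no axiom, no named fact, no `sorry`);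
kernel lane `--kind proof --supports stmt-HodgeConjecture-24833`.  Cell `pub/hodgecm-mathlib`, crux H413 (`stmt-HodgeConjecture-24833`), F0∕P3c line LH3, DIRECT ROAD of `stub_N9`,
organ O-L2 «Transf» (load-bearing); brick **(W-DISCHARGE)** (LH3-plan (g2) 06:34:00Z, HANDOFF-LH3-plan-g2 board l.16); seat LH4-p01 (g2).  Count-neutral.

THE MATHEMATICS.  ★ `archBzWeyl_transfFam` (LH7-p02) proves the (W)-clause of the candidate transfer family `transfFam L α μ F` from `ArchHcWeyl` of `F` and THREE `Δ″`-identities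
(`hΔflip`, `hΔnegH`, `hΔnegG`) plus continuity, each quantified over EVERY chart label `S`.  Two of them are now ★ for every `S` (`hΔflip`, `hΔnegH`: ★ p849871, `Δ″` is constant on
stable classes of `γ_H`); the third, `hΔnegG`, holds exactly on the ADMISSIBLE labels `S ⊆ splitChartPlaces L α` (★ p849882: there the reflected `G′`-chart point is CONJUGATE to
the original, ★ p849857) and is FALSE as stated on an inadmissible label (a place `w ∈ S` outside `splitChartPlaces`: the `G′`-chart falls back to the compact chart and `x_w ↦ −x_w`
negates an eigenvalue ANGLE — LH3-plan (g2)'s finding 06:34Z).  On an inadmissible label, however, NOTHING needs to be reflected: the `H`-chart point `endoTorus S c` is HYPERBOLIC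
at `w` (eigenvalues `e^{±x_w + iθ_w}`, `x_w ≠ 0` on `RegS S`) while every `G′`-chart point `gprimeTorus α S c′` is unitary-diagonal at `w` (eigenvalues on the unit circle), so the
two are never a norm pair (a norm pair has the same characteristic polynomial at every place — ★ `charpoly_archPiEquivCM_of_isArchNormPair`), every `Δ″` in the partner sum
vanishes (★ `archExplicitDelta_of_not_isArchNormPair`), `transfFamReg S = 0` on `RegS S`, and `transfFam S = 0` identically (`RegG`-limit of `0` is `0`, ★ `mem_closure_regG`;
`0` off `InRegS`) — Shelstad's «no contribution from Cartan subgroups that do not transfer» [Rogawski1990 (14.2.1)].  Hence (W) holds with NO `Δ″`-hypothesis and with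
continuity asked only on the admissible labels:
* §1 `not_isArchNormPair_endoTorus_gprimeTorus_of_not_mem_splitChartPlaces (hw : w ∈ S) (hsp : w ∉ splitChartPlaces L α) (hx : c w 0 ≠ 0) (c′)` (any `S′`);
* §2 **`transfFamReg_eq_zero_of_not_admissible (hS : ¬ ∀ w ∈ S, w ∈ splitChartPlaces L α) (hc : c ∈ RegS S)`**, **`transfFam_eq_zero_of_not_admissible (hS) : transfFam L α μ F S = fun _ => 0`**;
* §3 **`archBzWeyl_transfFam_of_hcWeyl (hF : ArchHcWeyl (slotSign L α) F) (hcont : ∀ S, (∀ w ∈ S, w ∈ splitChartPlaces L α) → ContinuousOn (transfFam L α μ F S) (InRegS S)) :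
  ArchBzWeyl (transfFam L α μ F)`** — admissible `S`: ★ ED. 2 per-label forms `transfFam_flipAt_mul_archRH_at` ∕ `transfFam_negXAt_at` fed with ★ p849871, ★ p849882 and `hF.2`;
  inadmissible `S`: both sides are `0` by §2.
HONEST LABEL: HC_CM is proved only modulo the 7 printed citations (2 remaining: hLiu418 = `stmt-HodgeConjecture-24832`, h413 = `stmt-HodgeConjecture-24833`) until rung 0 closes; this
file removes three hypotheses of an in-house clause of organ O-L2, nothing printed (+0∕+0).

## References
* [Rogawski1990] J. D. Rogawski, *Automorphic Representations of Unitary Groups in Three Variables*, Ann. of Math. Stud. 123 (1990), §4.3 (4.3.1) pp. 42–43 (norm pairs share the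
  characteristic polynomial; `Δ` supported on norm pairs), §14.2 (14.2.1) p. 232 («if `γ` does not occur in `G′`»), §14.3 p. 234.
* [Shelstad1979] D. Shelstad, *Characters and inner forms of a quasi-split group over ℝ*, Compositio Math. 39 (1979), §4 pp. 22–23 (condition (II); Cartan subgroups of `H` not
  arising from `G′`).
* [Bouaziz1994IntegralesOrbitales] A. Bouaziz, *Intégrales orbitales sur les groupes de Lie réductifs*, Ann. Sci. ÉNS 27 (1994), §3.1 p. 579, §6.2 p. 591.
-/

set_option autoImplicit false

noncomputable section

open NumberField NumberField.InfinitePlace Matrix Complex Set Filter Topology Polynomial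
open scoped MatrixGroups Matrix Classical Real
open Literature.NumberTheory.Automorphic Literature.NumberTheory.Automorphic.UnitaryGroup Literature.NumberTheory.Automorphic.ArchCartan
open Literature.NumberTheory.GaloisRepresentations

namespace Literature.NumberTheory.Rogawski1990

variable (L : Type) [Field L] [NumberField L] [IsCMField L] (α : Fin 3 → L) (μ : HeckeCharacter L)
  (F : Finset {w : InfinitePlace L // IsComplex w} → ({w : InfinitePlace L // IsComplex w} → Fin 3 → ℝ) → ℂ)

/-! ## §1 No norm partner at a split place of the `H`-chart that is not a split-chart place of the frame -/

/-- **NO PARTNER AT AN INADMISSIBLE PLACE.**  If `w ∈ S` is not a split-chart place of the frame `diag α` and `x_w = c w 0 ≠ 0`, then `endoTorus S c` (hyperbolic at `w`: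
eigenvalue `e^{x_w + iθ_w}` of modulus `e^{x_w} ≠ 1`) has NO norm partner among the chart points `gprimeTorus α S′ c′` (unitary-diagonal at `w`: all eigenvalues of modulus `1`),
for any label `S′` — a norm pair has equal characteristic polynomials at every place (★ `charpoly_archPiEquivCM_of_isArchNormPair`). [cite: Rogawski1990, §4.3 p. 42; §14.2 (14.2.1) p. 232]
[cite: Shelstad1979, §4 p. 22] -/
theorem not_isArchNormPair_endoTorus_gprimeTorus_of_not_mem_splitChartPlaces {S S' : Finset {w : InfinitePlace L // IsComplex w}}
    {w : {w : InfinitePlace L // IsComplex w}} (hw : w ∈ S) (hsp : ¬ w ∈ splitChartPlaces L α) {c : {w : InfinitePlace L // IsComplex w} → Fin 3 → ℝ} (hx : c w 0 ≠ 0)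
    (c' : {w : InfinitePlace L // IsComplex w} → Fin 3 → ℝ) :
    ¬ IsArchNormPair L (Matrix.diagonal α) (endoTorus L S c) (gprimeTorus L α S' c') := by
  intro h
  have hcp := charpoly_archPiEquivCM_of_isArchNormPair L (Matrix.diagonal α) (endoTorus L S c) (gprimeTorus L α S' c') h w
  rw [archPiEquivCM_gprimeTorus, coe_gprimeBlock_of_not_mem_splitChartPlaces L α c' hsp, charpoly_coe_gprimeCptGL, archPiEquivCM_endoTorus_fst,
    coe_endoBlock_of_mem L c hw] at hcp
  -- `z = e^{x + iθ}` is a root of the `H`-side characteristic polynomial at `w`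
  set z : ℂ := Complex.exp ((c w 0 : ℂ) + (c w 2 : ℂ) * I) with hz
  have hdiag : (!![Complex.exp ((c w 0 : ℂ) + (c w 2 : ℂ) * I), 0; 0, Complex.exp (-(c w 0 : ℂ) + (c w 2 : ℂ) * I)] : Matrix (Fin 2) (Fin 2) ℂ) =
      Matrix.diagonal ![z, Complex.exp (-(c w 0 : ℂ) + (c w 2 : ℂ) * I)] := by
    ext i j
    fin_cases i <;> fin_cases j <;> simp [Matrix.diagonal, hz]
  have hroot2 : ((Matrix.diagonal ![z, Complex.exp (-(c w 0 : ℂ) + (c w 2 : ℂ) * I)] : Matrix (Fin 2) (Fin 2) ℂ).charpoly).IsRoot z := by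
    rw [Matrix.charpoly_diagonal, Polynomial.isRoot_prod]
    exact ⟨0, Finset.mem_univ _, by simp⟩
  have hrootG : (∏ i : Fin 3, (X - Polynomial.C (Complex.exp ((c' w i : ℂ) * I)))).IsRoot z := by
    rw [hcp, hdiag]
    exact Polynomial.root_mul.2 (Or.inl hroot2)
  -- hence `z` is one of the unit-circle eigenvalues of the compact `G′`-chart: `‖z‖ = 1`, contradicting `‖z‖ = e^{x} ≠ 1`
  rw [Polynomial.isRoot_prod] at hrootG
  obtain ⟨k, -, hk⟩ := hrootG
  rw [Polynomial.root_X_sub_C] at hk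
  have h1 : ‖z‖ = 1 := by
    rw [← hk]
    exact Complex.norm_exp_ofReal_mul_I _
  have h2 : ‖z‖ = Real.exp (c w 0) := by
    rw [hz, Complex.norm_exp]
    simp
  rw [h2, Real.exp_eq_one_iff] at h1
  exact hx h1

/-! ## §2 The partner sum and the family member VANISH on an inadmissible label -/

/-- **`transfFamReg L α μ F S c = 0` on `RegS S` for an INADMISSIBLE label `S`** (some `w ∈ S` outside `splitChartPlaces L α`): every `Δ″` of the partner sum vanishes
(§1 + ★ `archExplicitDelta_of_not_isArchNormPair`). [cite: Rogawski1990, §4.3 (4.3.1) p. 43; §14.2 (14.2.1) p. 232] [cite: Shelstad1979, §4 p. 22] -/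
theorem transfFamReg_eq_zero_of_not_admissible {S : Finset {w : InfinitePlace L // IsComplex w}} (hS : ¬ ∀ w, w ∈ S → w ∈ splitChartPlaces L α)
    {c : {w : InfinitePlace L // IsComplex w} → Fin 3 → ℝ} (hc : c ∈ RegS S) :
    transfFamReg L α μ F S c = 0 := by
  simp only [not_forall] at hS
  obtain ⟨w, hw, hsp⟩ := hS
  unfold transfFamReg
  rw [Finset.sum_eq_zero (fun ρ _ => ?_), mul_zero]
  rw [archExplicitDelta_of_not_isArchNormPair L (Matrix.diagonal α) _ μ
      (not_isArchNormPair_endoTorus_gprimeTorus_of_not_mem_splitChartPlaces L α hw hsp (hc.2 w hw) _), zero_mul]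

/-- **`transfFam L α μ F S = 0` IDENTICALLY for an inadmissible label `S`**: on `RegG S` literally §2; on `InRegS S ∖ RegG S` the `RegG`-limit of the zero function is `0`
(★ `mem_closure_regG`, Mathlib `extendFrom_eq`); `0` off `InRegS S`. [cite: Rogawski1990, §14.2 (14.2.1) p. 232] [cite: Bouaziz1994IntegralesOrbitales, §3.1 p. 579; §6.2 p. 591] -/
theorem transfFam_eq_zero_of_not_admissible {S : Finset {w : InfinitePlace L // IsComplex w}} (hS : ¬ ∀ w, w ∈ S → w ∈ splitChartPlaces L α) :
    transfFam L α μ F S = fun _ => 0 := by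
  funext c
  by_cases hcr : c ∈ RegG S
  · rw [transfFam_of_mem_regG L α μ F S hcr]
    exact transfFamReg_eq_zero_of_not_admissible L α μ F hS (regG_subset_regS S hcr)
  · by_cases hci : c ∈ InRegS S
    · rw [transfFam_of_mem_inRegS_of_not_mem_regG L α μ F S hci hcr]
      refine extendFrom_eq (mem_closure_regG S c) ?_
      refine (tendsto_const_nhds (x := (0 : ℂ))).congr' ?_
      filter_upwards [self_mem_nhdsWithin] with x hx
      exact (transfFamReg_eq_zero_of_not_admissible L α μ F hS (regG_subset_regS S hx)).symm
    · exact transfFam_of_not_mem_inRegS L α μ F S hci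

/-! ## §3 (W) discharged -/

/-- **(W) FOR THE CANDIDATE TRANSFER FAMILY, DISCHARGED**: `ArchBzWeyl (transfFam L α μ F)` from `ArchHcWeyl (slotSign L α) F` and the continuity of `transfFam S` on `InRegS S`
at the ADMISSIBLE labels only (O-L2's (I₁), needed for the flip half's passage to the `G`-walls).  Admissible `S`: the ★ per-label forms with `hΔ` ∕ `hΔH` := ★ p849871,
`hΔG` := ★ p849882 (the realised reflection of the `G′`-atlas, ★ p849857), `hFS` := `hF.2`; inadmissible `S`: `transfFam S = 0` (§2), both clauses read `0 = 0`.
[cite: Shelstad1979, §4 p. 23] [cite: Rogawski1990, §4.3 (4.3.1) p. 43; §14.2 (14.2.1) p. 232] [cite: Bouaziz1994IntegralesOrbitales, §3.1 p. 579; §6.2 p. 591] -/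
theorem archBzWeyl_transfFam_of_hcWeyl (hF : ArchHcWeyl (slotSign L α) F)
    (hcont : ∀ S : Finset {w : InfinitePlace L // IsComplex w}, (∀ w, w ∈ S → w ∈ splitChartPlaces L α) → ContinuousOn (transfFam L α μ F S) (InRegS S)) :
    ArchBzWeyl (transfFam L α μ F) := by
  refine ⟨fun S c w hw => ?_, fun S c w hw => ?_⟩
  · by_cases hS : ∀ w, w ∈ S → w ∈ splitChartPlaces L α
    · exact transfFam_flipAt_mul_archRH_at L α μ F S hw (fun c γ' => archExplicitDelta_endoTorus_flipAt L (Matrix.diagonal α) S c hw μ γ') (hcont S hS) c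
    · simp only [transfFam_eq_zero_of_not_admissible L α μ F hS, zero_mul, mul_zero]
  · by_cases hS : ∀ w, w ∈ S → w ∈ splitChartPlaces L α
    · exact transfFam_negXAt_at L α μ F S hw (fun c => hF.2 S c w hw) (fun c γ' => archExplicitDelta_endoTorus_negXAt L (Matrix.diagonal α) S c hw μ γ')
        (fun c γH => archExplicitDelta_gprimeTorus_negXAt_of_forall L α μ hS hw γH c) c
    · simp only [transfFam_eq_zero_of_not_admissible L α μ F hS]

end Literature.NumberTheory.Rogawski1990

end
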